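import Summits.HodgeConjecture.CorCM.HypLiu418.A3Liu418GSCentralPlugTailCast
import HarnessLib

/-!
# GS-6 glue, the PLUG TAIL `(M, q, hfac)` of the face decomposition package — sequel: the packaged tail `exists_plugTail`

Cell hodgecm-mathlib (D-0151), crux `HLiu418` (stmt-HodgeConjecture-24832), line `a3_liu418`, placement row S-4δ.  PRE-SPLIT (director s168 (1)(d),
A-plan1 (g12) 18:24:37Z; cutter A-p18 (g10)): `exists_plugTail` ALONE (≈ 90 CPU-s synchronous), over `A3Liu418GSCentralPlugTailCast`
(`exists_factor_slice_mem_omegaHom_cast`); statement, proof and docstring BYTE-IDENTICAL to A-p19 (g10)՚s report-first e893fc5872862207, same namespace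
`Summit.HodgeConjecture.CorCM.Lines.A3Liu418`, same variable block, module name KEPT so that S-4 `A3Liu418GSFrobeniusOfThmD6` imports it unchanged.
See the Cast module for the full description of both theorems.  THEOREMS ONLY (no definition, no named fact, no instance, no `sorry`).
HC_CM is proved only modulo the 7 printed citations until rung 0 closes; nothing of [Liu2021] is asserted here.

References: [Liu2021] Y. Liu, *Fourier–Jacobi cycles and arithmetic relative trace formula*, Camb. J. Math. 9 (2021) = arXiv:2102.11518,
proof of Thm. 4.15 (FJcycle.tex l. 2199–2212), App. D §D.1 Step 3 (l. 5221); [GelbartRogawski1991] S. Gelbart, J. Rogawski,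
*L-functions and Fourier–Jacobi coefficients for the unitary group U(3)*, Invent. Math. 105 (1991), §3.1 Prop. 3.1.1 p. 455.
-/

set_option autoImplicit false

noncomputable section

namespace Summit.HodgeConjecture.CorCM.Lines.A3Liu418

open CategoryTheory NumberField IsDedekindDomain
open scoped TensorProduct Classical
open Literature.AlgebraicGeometry.Motives
open Literature.AlgebraicGeometry.ShimuraVarieties.UnitaryCanonicalModel
open Literature.NumberTheory.Automorphic Literature.NumberTheory.Automorphic.UnitaryGroup
open Literature.NumberTheory.Automorphic.Liu2021 Literature.NumberTheory.Automorphic.Liu2021.AppendixC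
open Summit.HodgeConjecture.CorCM.Model Summit.HodgeConjecture.CorCM.Model.HComp
open Literature.RepresentationTheory Literature.RepresentationTheory.TwistedCoinv
open Literature.NumberTheory.GelbartRogawski1991 Literature.NumberTheory.GelbartRogawski1991.UnitaryDualPair
open Literature.NumberTheory.GelbartRogawski1991.UnitaryDualPair.WeilCoinv
open Literature.NumberTheory.Weil1964

section G2cPlugTail

variable {F : CMField} {ι₁ : F →+* ℂ} {Jstar : Matrix (Fin 2) (Fin 2) F}
  {K₀ : C5.OpenCompactSubgroup ↥(finAdelic (↥(maximalRealSubfield F)) F (IsCMField.complexConj F) 2 Jstar)}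
  (S : RecordSystemGS F Jstar ι₁ K₀)
  (hU7ₛ : S.HeckeTranslateDefinedOver) (hLQ : S.IsLevelQuotient) (h4 : 4 ≤ Module.finrank ℚ F) (isoₛ : ℕ → Prop)
  (ℓ : ℕ) [Fact ℓ.Prime] (ι' : ℂ ≃+* AlgebraicClosure ℚ_[ℓ])
  -- (f1-adapted) data at `(F⁺, F, c̄)`, `M := 1`, `J_W := JW a`
  (N₁ N₂ : ℕ) {n n₁ n₂ : ℕ}
  (eV : Fin (N₁ + N₂) × Fin 1 ≃ Fin n) (e₁ : Fin N₁ × Fin 1 ≃ Fin n₁) (e₂ : Fin N₂ × Fin 1 ≃ Fin n₂)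
  (J₁ : Matrix (Fin N₁) (Fin N₁) (F : Type)) (J₂ : Matrix (Fin N₂) (Fin N₂) (F : Type))
  {T₁ : Matrix (Fin N₁) (Fin N₁) ↥(maximalRealSubfield (F : Type))} {T₂ : Matrix (Fin N₂) (Fin N₂) ↥(maximalRealSubfield (F : Type))}
  {δ : (F : Type)} (hcδ : (IsCMField.complexConj (F : Type)) δ = -δ) (hδ : δ ≠ 0) {d : ↥(maximalRealSubfield (F : Type))} (hd : δ * δ = algebraMap ↥(maximalRealSubfield (F : Type)) (F : Type) d)
  (h₁ : T₁.IsSymm) (h₂ : T₂.IsSymm) (h₁d : IsUnit T₁.det) (h₂d : IsUnit T₂.det) (hVd : IsUnit (finSum N₁ N₂ T₁ T₂).det)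
  (hJ₁ : J₁ = T₁.map (algebraMap ↥(maximalRealSubfield (F : Type)) (F : Type))) (hJ₂ : J₂ = T₂.map (algebraMap ↥(maximalRealSubfield (F : Type)) (F : Type)))
  (a : (↥(maximalRealSubfield (F : Type)))ˣ)
  {s : ↥(adelicPair ↥(maximalRealSubfield (F : Type)) (F : Type) (IsCMField.complexConj (F : Type)) (N₁ + N₂) 1 (finSum N₁ N₂ J₁ J₂) (Def411WeilCarriers.JW ↥(maximalRealSubfield (F : Type)) (F : Type) a)) →*
    adelicMpCont ↥(maximalRealSubfield (F : Type)) (Fin n) (adelicGram ↥(maximalRealSubfield (F : Type)) eV (finSum N₁ N₂ T₁ T₂) (Def411WeilCarriers.TW ↥(maximalRealSubfield (F : Type)) a))}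
  {s₁f : ∀ b : (↥(maximalRealSubfield (F : Type)))ˣ, ↥(adelicPair ↥(maximalRealSubfield (F : Type)) (F : Type) (IsCMField.complexConj (F : Type)) N₁ 1 J₁ (Def411WeilCarriers.JW ↥(maximalRealSubfield (F : Type)) (F : Type) b)) →*
    adelicMpCont ↥(maximalRealSubfield (F : Type)) (Fin n₁) (adelicGram ↥(maximalRealSubfield (F : Type)) e₁ T₁ (Def411WeilCarriers.TW ↥(maximalRealSubfield (F : Type)) b))}
  {s₂ : ↥(adelicPair ↥(maximalRealSubfield (F : Type)) (F : Type) (IsCMField.complexConj (F : Type)) N₂ 1 J₂ (Def411WeilCarriers.JW ↥(maximalRealSubfield (F : Type)) (F : Type) a)) →*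
    adelicMpCont ↥(maximalRealSubfield (F : Type)) (Fin n₂) (adelicGram ↥(maximalRealSubfield (F : Type)) e₂ T₂ (Def411WeilCarriers.TW ↥(maximalRealSubfield (F : Type)) a))}
  (hs : (splittingDatum ↥(maximalRealSubfield (F : Type)) (F : Type) (IsCMField.complexConj (F : Type)) (N₁ + N₂) 1 eV (finSum N₁ N₂ J₁ J₂) (Def411WeilCarriers.JW ↥(maximalRealSubfield (F : Type)) (F : Type) a) hcδ hδ hd
    (isSymm_finSum h₁ h₂) (Def411WeilCarriers.isSymm_TW ↥(maximalRealSubfield (F : Type)) a) hVd (Def411WeilCarriers.isUnit_det_TW ↥(maximalRealSubfield (F : Type)) a)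
    (finSum_eq_map_finSum ↥(maximalRealSubfield (F : Type)) (F : Type) N₁ N₂ J₁ J₂ hJ₁ hJ₂) (Def411WeilCarriers.JW_eq ↥(maximalRealSubfield (F : Type)) (F : Type) a)).IsCompatible s)
  (hs₁f : ∀ b : (↥(maximalRealSubfield (F : Type)))ˣ, (splittingDatum ↥(maximalRealSubfield (F : Type)) (F : Type) (IsCMField.complexConj (F : Type)) N₁ 1 e₁ J₁ (Def411WeilCarriers.JW ↥(maximalRealSubfield (F : Type)) (F : Type) b) hcδ hδ hd h₁
    (Def411WeilCarriers.isSymm_TW ↥(maximalRealSubfield (F : Type)) b) h₁d (Def411WeilCarriers.isUnit_det_TW ↥(maximalRealSubfield (F : Type)) b) hJ₁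
    (Def411WeilCarriers.JW_eq ↥(maximalRealSubfield (F : Type)) (F : Type) b)).IsCompatible (s₁f b))
  (hs₂ : (splittingDatum ↥(maximalRealSubfield (F : Type)) (F : Type) (IsCMField.complexConj (F : Type)) N₂ 1 e₂ J₂ (Def411WeilCarriers.JW ↥(maximalRealSubfield (F : Type)) (F : Type) a) hcδ hδ hd h₂
    (Def411WeilCarriers.isSymm_TW ↥(maximalRealSubfield (F : Type)) a) h₂d (Def411WeilCarriers.isUnit_det_TW ↥(maximalRealSubfield (F : Type)) a) hJ₂
    (Def411WeilCarriers.JW_eq ↥(maximalRealSubfield (F : Type)) (F : Type) a)).IsCompatible s₂)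
  (hχV : ∀ g₁ : ↥(adelic ↥(maximalRealSubfield (F : Type)) (F : Type) (IsCMField.complexConj (F : Type)) N₁ J₁), mpSeesawCharLeft ↥(maximalRealSubfield (F : Type)) (F : Type) (IsCMField.complexConj (F : Type)) N₁ N₂ 1 eV e₁ e₂ J₁ J₂ (Def411WeilCarriers.JW ↥(maximalRealSubfield (F : Type)) (F : Type) a) hcδ hδ hd h₁ h₂ (Def411WeilCarriers.isSymm_TW ↥(maximalRealSubfield (F : Type)) a) h₁d h₂d (Def411WeilCarriers.isUnit_det_TW ↥(maximalRealSubfield (F : Type)) a) hVd hJ₁ hJ₂ (Def411WeilCarriers.JW_eq ↥(maximalRealSubfield (F : Type)) (F : Type) a) hs (hs₁f a) hs₂ ((g₁, 1), 1) = 1)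
  (χface : Def411WeilCarriers.Chi ↥(maximalRealSubfield (F : Type)) (F : Type) (IsCMField.complexConj (F : Type)))
  (θ : ↥(finAdelic (↥(maximalRealSubfield F)) F (IsCMField.complexConj F) 2 Jstar) →* ↥(finAdelic ↥(maximalRealSubfield (F : Type)) (F : Type) (IsCMField.complexConj (F : Type)) N₁ J₁))

set_option maxHeartbeats 400000 in -- measured ≤ 200 k in the by-paste harness; one 2× line kept for the (160 k, 200 k] margin class (A-p19 (g10) O5)
include e₂ h₂d hs₂ hχV in
/-- **THE PLUG TAIL OF `DecompositionAtFace(Adapted)` — `(M, q, hfac)` — GENERIC over the plug՚s variables and an ABSTRACT identification `C`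
of some `U(J⋆)(𝔸_f)`-module `X` (at the face: `ω_{D′}(ν, ε′, χ′) ∘ φGS`, identified with the split model by the (J5) append cast after unfolding
the face carriers) with the plug representation `ω_χ ∘ (· ⊕ᶠ 1) ∘ θ`: multiplicity modules `M i := Coinv (ω_f[J₂] through the line) (χ″·ψ̃ᵢ⁻¹)`,
maps `q i := ((plugE ⊗ 1) ∘ q_ψ̃ᵢ ∘ Φ_plug) ∘ C`, and for every `f′ ∈ Hom_{U(J⋆)}(ι′ ∘ ρ_X, ℚ_ℓ^{ac} ⊗ H¹_ét)` the factorisation `p_ψ ∘ f′ = g ∘ q i`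
with slices in `Hom(ι′ ∘ (rhoVAtLine[J₁] … a ψ̃ ∘ θ), …)` — A-p12՚s `exists_factor_slice_mem_omegaHom_plug′` repackaged; composed over VARIABLES
so that the face instantiates it syntactically and `X` keeps its own module instances end to end (the `Coinv`-vs-`𝕌`-model instance wall).
[cite: Liu2021, proof of Thm. 4.15 (FJcycle.tex l. 2199–2212); App. D §D.1 Step 3 (l. 5221)] [cite: GelbartRogawski1991, §3.1 Prop. 3.1.1 p. 455] -/
theorem exists_plugTail
    (hθ : ∀ z : ↥(finAdelicOne ↥(maximalRealSubfield (F : Type)) (F : Type) (IsCMField.complexConj (F : Type))), θ (finAdelicCenter ↥(maximalRealSubfield (F : Type)) (F : Type) (IsCMField.complexConj (F : Type)) 2 Jstar z) = finAdelicCenter ↥(maximalRealSubfield (F : Type)) (F : Type) (IsCMField.complexConj (F : Type)) N₁ J₁ z)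
    {X : Type} [AddCommGroup X] [Module ℂ X]
    (ρX : Representation ℂ ↥(finAdelic (↥(maximalRealSubfield F)) F (IsCMField.complexConj F) 2 Jstar) X)
    (C : X ≃ₗ[ℂ] Coinv (finPairRepW ↥(maximalRealSubfield (F : Type)) (F : Type) (IsCMField.complexConj (F : Type)) (N₁ + N₂) 1 eV (finSum N₁ N₂ J₁ J₂) (Def411WeilCarriers.JW ↥(maximalRealSubfield (F : Type)) (F : Type) a) hcδ hδ hd (isSymm_finSum h₁ h₂) (Def411WeilCarriers.isSymm_TW ↥(maximalRealSubfield (F : Type)) a) hVd (Def411WeilCarriers.isUnit_det_TW ↥(maximalRealSubfield (F : Type)) a) (finSum_eq_map_finSum ↥(maximalRealSubfield (F : Type)) (F : Type) N₁ N₂ J₁ J₂ hJ₁ hJ₂) (Def411WeilCarriers.JW_eq ↥(maximalRealSubfield (F : Type)) (F : Type) a) hs) (Def411WeilCarriers.lineChar ↥(maximalRealSubfield (F : Type)) (F : Type) (IsCMField.complexConj (F : Type)) a χface.1))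
    (hC : ∀ (u : ↥(finAdelic (↥(maximalRealSubfield F)) F (IsCMField.complexConj F) 2 Jstar)) (w : Coinv (finPairRepW ↥(maximalRealSubfield (F : Type)) (F : Type) (IsCMField.complexConj (F : Type)) (N₁ + N₂) 1 eV (finSum N₁ N₂ J₁ J₂) (Def411WeilCarriers.JW ↥(maximalRealSubfield (F : Type)) (F : Type) a) hcδ hδ hd (isSymm_finSum h₁ h₂) (Def411WeilCarriers.isSymm_TW ↥(maximalRealSubfield (F : Type)) a) hVd (Def411WeilCarriers.isUnit_det_TW ↥(maximalRealSubfield (F : Type)) a) (finSum_eq_map_finSum ↥(maximalRealSubfield (F : Type)) (F : Type) N₁ N₂ J₁ J₂ hJ₁ hJ₂) (Def411WeilCarriers.JW_eq ↥(maximalRealSubfield (F : Type)) (F : Type) a) hs) (Def411WeilCarriers.lineChar ↥(maximalRealSubfield (F : Type)) (F : Type) (IsCMField.complexConj (F : Type)) a χface.1)),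
      C.symm (plugRho N₁ N₂ eV J₁ J₂ hcδ hδ hd h₁ h₂ hVd hJ₁ hJ₂ a hs χface θ u w) = ρX u (C.symm w)) :
    ∃ (M : OccWeight S hU7ₛ hLQ h4 isoₛ ℓ → ModuleCat.{0} ℂ)
      (q : ∀ i : OccWeight S hU7ₛ hLQ h4 isoₛ ℓ, X →ₗ[ℂ] Def411WeilCarriers.omegaAtLine ↥(maximalRealSubfield (F : Type)) (F : Type) (IsCMField.complexConj (F : Type)) N₁ e₁ J₁ hcδ hδ hd h₁ h₁d hJ₁ hs₁f a (occChi S hU7ₛ hLQ h4 isoₛ ℓ ι' i) ⊗[ℂ] M i),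
      ∀ i : OccWeight S hU7ₛ hLQ h4 isoₛ ℓ, ∀ f' ∈ (etaleHeckeDatumGS S hU7ₛ hLQ h4 isoₛ ℓ).omegaHom ι' ρX,
        ∃ g : Def411WeilCarriers.omegaAtLine ↥(maximalRealSubfield (F : Type)) (F : Type) (IsCMField.complexConj (F : Type)) N₁ e₁ J₁ hcδ hδ hd h₁ h₁d hJ₁ hs₁f a (occChi S hU7ₛ hLQ h4 isoₛ ℓ ι' i) ⊗[ℂ] M i →ₛₗ[(ι' : ℂ →+* AlgebraicClosure ℚ_[ℓ])] AlgebraicClosure ℚ_[ℓ] ⊗[ℚ_[ℓ]] (sec42DataGS S h4 isoₛ).etaleH1Tower ℓ,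
          (∀ w, occProj S hU7ₛ hLQ h4 isoₛ ℓ i (f' w) = g (q i w)) ∧
          ∀ m : M i, g.comp ((TensorProduct.mk ℂ (Def411WeilCarriers.omegaAtLine ↥(maximalRealSubfield (F : Type)) (F : Type) (IsCMField.complexConj (F : Type)) N₁ e₁ J₁ hcδ hδ hd h₁ h₁d hJ₁ hs₁f a (occChi S hU7ₛ hLQ h4 isoₛ ℓ ι' i)) (M i)).flip m) ∈
            (etaleHeckeDatumGS S hU7ₛ hLQ h4 isoₛ ℓ).omegaHom ι' (plugRho' S hU7ₛ hLQ h4 isoₛ ℓ ι' N₁ e₁ J₁ hcδ hδ hd h₁ h₁d hJ₁ a hs₁f θ i.1 i.2.choose_spec) := by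
  refine ⟨fun i => ModuleCat.of ℂ (Coinv (plugRho₂ N₂ e₂ J₂ hcδ hδ hd h₂ h₂d hJ₂ a hs₂) (plugChi N₁ N₂ eV e₁ e₂ J₁ J₂ hcδ hδ hd h₁ h₂ h₁d h₂d hVd hJ₁ hJ₂ a hs hs₁f hs₂ χface * (psiTilde ℓ ι' i.1)⁻¹)), fun i =>
    ((((TensorProduct.congr (plugE S hU7ₛ hLQ h4 isoₛ ℓ ι' N₁ e₁ J₁ hcδ hδ hd h₁ h₁d hJ₁ a hs₁f i.1 i.2.choose_spec) (LinearEquiv.refl ℂ (Coinv (plugRho₂ N₂ e₂ J₂ hcδ hδ hd h₂ h₂d hJ₂ a hs₂) (plugChi N₁ N₂ eV e₁ e₂ J₁ J₂ hcδ hδ hd h₁ h₂ h₁d h₂d hVd hJ₁ hJ₂ a hs hs₁f hs₂ χface * (psiTilde ℓ ι' i.1)⁻¹)))).toLinearMap :) ∘ₗ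
          ((coinvTprodQuot (plugRho₁ N₁ e₁ J₁ hcδ hδ hd h₁ h₁d hJ₁ a hs₁f) (plugRho₂ N₂ e₂ J₂ hcδ hδ hd h₂ h₂d hJ₂ a hs₂) (plugChi N₁ N₂ eV e₁ e₂ J₁ J₂ hcδ hδ hd h₁ h₂ h₁d h₂d hVd hJ₁ hJ₂ a hs hs₁f hs₂ χface) (psiTilde ℓ ι' i.1) :) ∘ₗ
            ((plugPhi N₁ N₂ eV e₁ e₂ J₁ J₂ hcδ hδ hd h₁ h₂ h₁d h₂d hVd hJ₁ hJ₂ a hs hs₁f hs₂ hχV χface).toLinearMap :))) ∘ₗ (C.toLinearMap :)), ?_⟩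
  intro i f' hf'
  -- per label, through the cast (`occProj … i = weightProj … i.1 …` by `rfl`)
  exact exists_factor_slice_mem_omegaHom_cast S hU7ₛ hLQ h4 isoₛ ℓ ι' N₁ N₂ eV e₁ e₂ J₁ J₂ hcδ hδ hd h₁ h₂ h₁d h₂d hVd hJ₁ hJ₂ a hs hs₁f hs₂
    hχV χface θ hθ ρX C hC i.1 i.2.choose_spec hf'

end G2cPlugTail

end Summit.HodgeConjecture.CorCM.Lines.A3Liu418

end
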